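import Literature.AlgebraicGeometry.Resolution.MacaulayficationSecantSequences
import Mathlib.RingTheory.Support
import HarnessLib

/-!
# Parts of systems of parameters: sublists, powers and products (Česnavičius 2021, §3.2)

Topic: `Literature/AlgebraicGeometry/Resolution`. Sequel of `MacaulayficationSecantSequences.lean`
(secant sequences `IsSecantSequence M rs`, Česnavičius 2021 Def. 3.1 (i) = parts of systems of
parameters of a finite module over a Noetherian local ring). Brick of the proof of the named facts
`KawasakiMacaulayfication` / `CesnaviciusMacaulayfication`: Kawasaki's calculus of `p`-standard
systems of parameters (Kawasaki 2000, §2–§3) manipulates parts of systems of parameters in three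
ways that the first file left out ("What is NOT here" there), all from the first paragraph of
Česnavičius 2021, §3.2:

* `IsSecantSequence.sublist` — a sub-sequence (in order) of a secant sequence in `𝔪` is secant
  ("any permutation of a secant sequence is still secant" + initial segments);
* `isSecantSequence_congr_of_forall₂`, `IsSecantSequence.append_pow` — secant-ness only depends on
  the radicals of the entries; in particular `r₁,…,rᵢ₋₁, rᵢⁿ` is secant iff `r₁,…,rᵢ` is;
* `IsSecantSequence.append_mul` — "as is any `r₁, …, rᵢ₋₁, rᵢrⱼ`": if `W, a` and `W, b` are secant
  then so is `W, ab` ("neither `a` nor `b` vanishes at any point of `Supp(M/(W)M)` of maximal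
  coheight"), via `supportDim_quotient_sup_span_mul_le`:
  `dim Supp M/(K + (ab))M ≤ max (dim Supp M/(K + (a))M) (dim Supp M/(K + (b))M)`, itself from the
  poset fact `krullDim_inter_union_le` (a chain in a union of two upper sets lies in one of them).

Everything is proved; no named fact is introduced.

## References

* [Cesnavicius2021] K. Česnavičius, *Macaulayfication of Noetherian schemes*, Duke Math. J. 170
  (2021) = arXiv:1810.04493v2, §3.2 (first paragraph after Def. 3.1).
* [Kawasaki2000] T. Kawasaki, *On Macaulayfication of Noetherian schemes*, Trans. AMS 352 (2000)
  2517–2552, §2 (where these manipulations are used tacitly: "since `y₁,…,y_u,x_{s+1}^{n_{s+1}},…`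
  and `…, x_i^{n_i}x_j^{n_j}` are two subsystems of parameters for `M`", proof of Prop. 2.8).
* The Stacks Project, Tag 00L3 (`Supp(M/IM) = Supp(M) ∩ V(I)`) — Mathlib `Module.support_quotient`.
-/

namespace Literature.AlgebraicGeometry.Resolution

open Ideal Submodule Module IsLocalRing PrimeSpectrum
open scoped Pointwise

universe u v

/-! ## A chain in a union of two upper sets lies in one of them -/

section Poset

variable {α : Type*} [Preorder α]

/-- If `s` and `t` are upper sets of a preorder then every strictly increasing chain in
`u ∩ (s ∪ t)` lies in `u ∩ s` or in `u ∩ t` (according to its first element), so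
`krullDim (u ∩ (s ∪ t)) ≤ max (krullDim (u ∩ s)) (krullDim (u ∩ t))`. [folklore] -/
theorem krullDim_inter_union_le (u s t : Set α) (hs : IsUpperSet s) (ht : IsUpperSet t) :
    Order.krullDim ↥(u ∩ (s ∪ t)) ≤
      max (Order.krullDim ↥(u ∩ s)) (Order.krullDim ↥(u ∩ t)) := by
  simp only [Order.krullDim]
  refine iSup_le fun p => ?_
  have hmono : ∀ i : Fin (p.length + 1),
      ((p.head : ↥(u ∩ (s ∪ t))) : α) ≤ ((p i : ↥(u ∩ (s ∪ t))) : α) := fun i =>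
    p.monotone (Fin.zero_le i)
  rcases p.head.2.2 with h0 | h0
  · let q : LTSeries ↥(u ∩ s) :=
      { length := p.length
        toFun := fun i => ⟨(p i : α), (p i).2.1, hs (hmono i) h0⟩
        step := fun i => p.step i }
    exact le_max_of_le_left (le_iSup_of_le q le_rfl)
  · let q : LTSeries ↥(u ∩ t) :=
      { length := p.length
        toFun := fun i => ⟨(p i : α), (p i).2.1, ht (hmono i) h0⟩
        step := fun i => p.step i }
    exact le_max_of_le_right (le_iSup_of_le q le_rfl)

end Poset

section Module

variable {R : Type u} [CommRing R] {M : Type v} [AddCommGroup M] [Module R M]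

/-- Zero loci `V(s) ⊆ Spec R` are stable under specialization (upper sets for the order
`𝔭 ≤ 𝔮 ↔ 𝔭 ⊆ 𝔮`). [folklore] -/
theorem isUpperSet_zeroLocus (s : Set R) : IsUpperSet (zeroLocus s) :=
  fun p q hpq hp => Set.Subset.trans hp
    (SetLike.coe_subset_coe.mpr ((PrimeSpectrum.asIdeal_le_asIdeal p q).mpr hpq))

/-! ## Products: `dim Supp M/(K + (ab))M ≤ max (dim Supp M/(K + (a))M, dim Supp M/(K + (b))M)` -/

section Finite

variable [Module.Finite R M]

/-- **Dimension of the quotient by a product**: for a finite module `M`, an ideal `K` and ring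
elements `a, b`, `dim Supp(M/(K + (ab))M) ≤ max (dim Supp(M/(K + (a))M)) (dim Supp(M/(K + (b))M))`
— indeed `Supp(M/(K + (ab))M) = Supp M ∩ V(K) ∩ (V(a) ∪ V(b))` (Stacks 00L3) and a chain of primes in
a union of two closed-under-specialization sets lies in one of them. (Equality holds, but only `≤`
is used.) [folklore] -/
theorem supportDim_quotient_sup_span_mul_le (K : Ideal R) (a b : R) :
    supportDim R (M ⧸ ((K ⊔ span {a * b}) • ⊤ : Submodule R M)) ≤
      max (supportDim R (M ⧸ ((K ⊔ span {a}) • ⊤ : Submodule R M)))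
        (supportDim R (M ⧸ ((K ⊔ span {b}) • ⊤ : Submodule R M))) := by
  have key : ∀ c : R, support R (M ⧸ ((K ⊔ span {c}) • ⊤ : Submodule R M)) =
      (support R M ∩ zeroLocus (K : Set R)) ∩ zeroLocus {c} := fun c => by
    rw [support_quotient, zeroLocus_sup, zeroLocus_span {c}, Set.inter_assoc]
  have hdim : ∀ c : R, supportDim R (M ⧸ ((K ⊔ span {c}) • ⊤ : Submodule R M)) =
      Order.krullDim ↥((support R M ∩ zeroLocus (K : Set R)) ∩ zeroLocus {c}) := fun c =>
    congrArg (fun S : Set (PrimeSpectrum R) => Order.krullDim ↥S) (key c)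
  rw [hdim, hdim, hdim, zeroLocus_singleton_mul]
  exact krullDim_inter_union_le _ _ _ (isUpperSet_zeroLocus {a}) (isUpperSet_zeroLocus {b})

/-- **"As is any `r₁, …, rᵢ₋₁, rᵢrⱼ`"** (Česnavičius 2021, §3.2): if `W, a` and `W, b` are secant
for `M` then so is `W, ab` — neither `a` nor `b` vanishes at a point of `Supp(M/(W)M)` of maximal
coheight, hence neither does `ab`. [cite: Cesnavicius2021, §3.2] -/
theorem IsSecantSequence.append_mul {W : List R} {a b : R}
    (ha : IsSecantSequence M (W ++ [a])) (hb : IsSecantSequence M (W ++ [b])) :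
    IsSecantSequence M (W ++ [a * b]) := by
  intro i hi
  rw [List.length_append, List.length_singleton] at hi
  rcases Nat.lt_succ_iff_lt_or_eq.mp hi with hi | rfl
  · -- the conditions at `i < |W|` only involve prefixes of `W`
    have h1 : (W ++ [a * b]).take (i + 1) = (W ++ [a]).take (i + 1) := by
      rw [List.take_append_of_le_length (by omega), List.take_append_of_le_length (by omega)]
    have h2 : (W ++ [a * b]).take i = (W ++ [a]).take i := by
      rw [List.take_append_of_le_length (by omega), List.take_append_of_le_length (by omega)]
    rw [h1, h2]
    exact ha i (by simpa using Nat.lt_succ_of_lt hi)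
  · -- the condition at `i = |W|`: `dim M/(W, ab)M < dim M/(W)M`
    have e1 : ∀ c : R, (W ++ [c]).take (W.length + 1) = W ++ [c] := fun c =>
      List.take_of_length_le (by simp)
    have e2 : ∀ c : R, (W ++ [c]).take W.length = W := fun c => List.take_left
    have e3 : ∀ c : R, (ofList (W ++ [c]) : Ideal R) = ofList W ⊔ span {c} := fun c => by
      rw [ofList_append, ofList_singleton]
    have ha' := ha W.length (by simp)
    have hb' := hb W.length (by simp)
    rw [e1, e2, e3] at ha' hb' ⊢
    exact (supportDim_quotient_sup_span_mul_le (M := M) (ofList W) a b).trans_lt (max_lt ha' hb')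

/-! ## Powers: secant-ness only depends on the radicals of the entries -/

/-- Lists with entrywise equal zero loci generate ideals with equal zero loci. [folklore] -/
theorem zeroLocus_ofList_eq_of_forall₂ {l l' : List R}
    (h : List.Forall₂ (fun r r' => zeroLocus ({r} : Set R) = zeroLocus {r'}) l l') :
    zeroLocus (ofList l : Set R) = zeroLocus (ofList l') := by
  induction h with
  | nil => rfl
  | @cons a b l₁ l₂ hd _ ih =>
    rw [ofList_cons, ofList_cons, zeroLocus_sup, zeroLocus_sup, ih, zeroLocus_span {a},
      zeroLocus_span {b}, hd]

/-- **Secant-ness only depends on the radicals of the entries**: if `rs` and `rs'` have entrywise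
equal zero loci `V(rᵢ) = V(r'ᵢ)` then `rs` is secant for `M` iff `rs'` is (the supports
`Supp(M/(r₁,…,rᵢ)M) = Supp M ∩ V(r₁,…,rᵢ)` agree, Stacks 00L3). [folklore] -/
theorem isSecantSequence_congr_of_forall₂ {rs rs' : List R}
    (h : List.Forall₂ (fun r r' => zeroLocus ({r} : Set R) = zeroLocus {r'}) rs rs') :
    IsSecantSequence M rs ↔ IsSecantSequence M rs' := by
  have hlen := h.length_eq
  have key : ∀ i, supportDim R (M ⧸ (ofList (rs.take i) • ⊤ : Submodule R M)) =
      supportDim R (M ⧸ (ofList (rs'.take i) • ⊤ : Submodule R M)) := fun i =>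
    congrArg (fun S : Set (PrimeSpectrum R) => Order.krullDim ↥S)
      (show support R (M ⧸ (ofList (rs.take i) • ⊤ : Submodule R M)) =
          support R (M ⧸ (ofList (rs'.take i) • ⊤ : Submodule R M)) by
        rw [support_quotient, support_quotient,
          zeroLocus_ofList_eq_of_forall₂ (List.forall₂_take i h)])
  simp only [IsSecantSequence, key, hlen]

/-- The entrywise relation `V(r) = V(r')` is reflexive on lists. [folklore] -/
theorem forall₂_zeroLocus_refl (l : List R) :
    List.Forall₂ (fun r r' => zeroLocus ({r} : Set R) = zeroLocus {r'}) l l :=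
  List.forall₂_same.mpr fun _ _ => rfl

/-- **`W, wⁿ` is secant iff `W, w` is** (`n ≥ 1`; `V(wⁿ) = V(w)`). [cite: Cesnavicius2021, §3.2] -/
theorem isSecantSequence_append_pow_iff (W : List R) (w : R) {n : ℕ} (hn : 0 < n) :
    IsSecantSequence M (W ++ [w ^ n]) ↔ IsSecantSequence M (W ++ [w]) :=
  isSecantSequence_congr_of_forall₂ (List.rel_append (forall₂_zeroLocus_refl W)
    (List.Forall₂.cons (zeroLocus_singleton_pow w n hn) List.Forall₂.nil))

/-- If `W, w` is secant for `M` then so is `W, wⁿ` for `n ≥ 1`. [cite: Cesnavicius2021, §3.2] -/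
theorem IsSecantSequence.append_pow {W : List R} {w : R} (h : IsSecantSequence M (W ++ [w]))
    {n : ℕ} (hn : 0 < n) : IsSecantSequence M (W ++ [w ^ n]) :=
  (isSecantSequence_append_pow_iff W w hn).mpr h

/-- **Powers inside**: if `W, w, W'` is secant for `M` then so is `W, wⁿ, W'` for `n ≥ 1`.
[cite: Cesnavicius2021, §3.2] -/
theorem IsSecantSequence.append_pow_append {W W' : List R} {w : R}
    (h : IsSecantSequence M (W ++ [w] ++ W')) {n : ℕ} (hn : 0 < n) :
    IsSecantSequence M (W ++ [w ^ n] ++ W') :=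
  (isSecantSequence_congr_of_forall₂ (List.rel_append (List.rel_append (forall₂_zeroLocus_refl W)
    (List.Forall₂.cons (zeroLocus_singleton_pow w n hn) List.Forall₂.nil))
      (forall₂_zeroLocus_refl W'))).mpr h

end Finite

/-! ## Sublists of secant sequences -/

section LocalRing

variable [IsNoetherianRing R] [IsLocalRing R] [Module.Finite R M]

/-- **Sub-sequences of parts of systems of parameters are parts of systems of parameters**: if
`rs ⊆ 𝔪` is secant for `M` then so is every sublist `rs'` of `rs` (in order) — permute the
omitted entries to the end (Česnavičius 2021, §3.2: "any permutation of a secant sequence is still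
secant") and take the initial segment. [cite: Cesnavicius2021, §3.2] -/
theorem IsSecantSequence.sublist {rs rs' : List R} (h : IsSecantSequence M rs)
    (hsub : rs'.Sublist rs) (hrs : ∀ r ∈ rs, r ∈ maximalIdeal R) : IsSecantSequence M rs' := by
  obtain ⟨l, hl⟩ := hsub.exists_perm_append
  have := (h.of_perm hl hrs).take rs'.length
  rwa [List.take_left] at this

/-- **Sub-sequences followed by a permutation**: if `rs ⊆ 𝔪` is secant for `M`, `rs'` is a
sublist of `rs` and `rs''` is a permutation of `rs'`, then `rs''` is secant for `M` — the form in
which Kawasaki's proofs invoke "`y₁,…,y_u,xᵢ,…,x_k` is a subsystem of parameters"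
(Kawasaki 2000, proofs of 2.8–2.10). [cite: Kawasaki2000, §2] -/
theorem IsSecantSequence.of_sublist_perm {rs rs' rs'' : List R} (h : IsSecantSequence M rs)
    (hsub : rs'.Sublist rs) (hp : rs'.Perm rs'') (hrs : ∀ r ∈ rs, r ∈ maximalIdeal R) :
    IsSecantSequence M rs'' :=
  (h.sublist hsub hrs).of_perm hp fun r hr => hrs r (hsub.subset hr)

end LocalRing

end Module

end Literature.AlgebraicGeometry.Resolution
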